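import Summits.AtomisticToContinuum.Crystallization.Theorems.FrustratedLawDichotomyCellEflatClassesA
import Summits.AtomisticToContinuum.Crystallization.Theorems.FrustratedLawDichotomyCellEflatClassesB
import Summits.AtomisticToContinuum.Crystallization.Theorems.FrustratedLawDichotomyCellEflatClassesC
import Summits.AtomisticToContinuum.Crystallization.Theorems.FrustratedLawDichotomyCellEflatClassesD

/-!
# FrustratedLawDichotomy · crux `AperiodicFrustratedLawGap` (stmt-AtomisticToContinuum-27623) — ★ A CERTIFIED CEILING ON E′♭₄₅:
# `SchurElasticPricing (1/20) (1/8) w₄₅ ω₄ (3/400) (−0.7175) κ_E C_E D_E` is FALSE for every `κ_E ≥ 1.0712·10⁻³` and ALL `C_E, D_E`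
# (decomp-a2c, prover hand 1, generation 15; critic rows 543 (B3)(2) / 555 (B) / 564 (i) — the g14 numerical ceiling, now kernel-checked, axioms standard)

THE WITNESS (`…CellEflatData.cellE`): hand-1 g14's all-strained hcp 2×2×2 cell `cell_nm_0503` in the hcp frame, denominator `10⁶`.
THE CERTIFICATE (`cellECert`, sixteen `decide +kernel` evaluations in `…CellEflatClassesA–D`): every site has nearest-neighbour distance
`d ∈ {0.95222, 0.95225}`, a clean twelve-shell (`r₁₃/d ≥ 1.404`, gap `1/50`), an hcp fit with `A = ±id` at misfit `0.0564 < 1249/10000 < 1/8` (it is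
`1/8`-GOOD), and its twelfth neighbour at `r₁₂/d = 1.05035 ≥ 21/20`, so by the ROTATION-FREE radial obstruction (`…CellKitF.not_goodAt_of_radial`) it is
NOT `1/20`-good for any isometry and any assignment (the g14 sup-misfit `0.05035` is purely radial); the `W₄₅` site sums are bounded termwise by
`…CellKitW.effPot_le_ubW` (enclosures of width `10⁻¹¹`, rounded up to `2⁻⁴⁰`): mean priced site energy `≤ −0.7175 + 1.0711880·10⁻³`
(float cross-check `1.0711878·10⁻³`; g14 interval value `x̄(κ_E = 10⁻³) = +7.11952·10⁻⁵`).
THE THEOREM ★ `not_schurElasticPricing_fourHalf_of_ge`: `10712/10⁷ ≤ κ_E → ∀ C_E D_E, ¬ SchurElasticPricing (1/20) (1/8) w₄₅ ω₄ (3/400) (−7175/10000) κ_E C_E D_E`,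
through `…CellCheckerSound.not_schurElasticPricing_fourHalf_of_check` and hand-2 g15's periodic-block negative kernel
`…PeriodicBlockViolation.not_schurElasticPricing_of_cell`.  READING for the column of record (`…SchurCut` E′♭ at range 9/2, `…OptimalityCut`):
the literal `κ_E = 1/1000` is NOT refuted (it survives this witness by `7.1·10⁻⁵` per site), but no constant `κ_E ≥ 1.0712·10⁻³` is available for
any `C_E, D_E`.  All `[folklore]`; 0 sorry; no `native_decide`.
-/

namespace Summit.AtomisticToContinuum.Crystallization.Theorems.FrustratedLawDichotomyCellEflatCeiling

open Summit.AtomisticToContinuum.Crystallization.Theorems.FrustratedLawDichotomySchurCut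
open Summit.AtomisticToContinuum.Crystallization.Theorems.FrustratedLawDichotomyCellChecker

/-- All sixteen classes of `cellE` pass `checkClass`. [folklore] -/
theorem cellE_checkClass : ∀ m : Fin cellE.N₀, cellE.checkClass m (cellECert m) = true := by
  intro m
  obtain ⟨m, hm⟩ := m
  have hm' : m < 16 := hm
  interval_cases m
  exacts [cellE_checkClass0, cellE_checkClass1, cellE_checkClass2, cellE_checkClass3, cellE_checkClass4, cellE_checkClass5, cellE_checkClass6, cellE_checkClass7, cellE_checkClass8, cellE_checkClass9, cellE_checkClass10, cellE_checkClass11, cellE_checkClass12, cellE_checkClass13, cellE_checkClass14, cellE_checkClass15]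

/-- ★★ **THE CERTIFIED CEILING ON E′♭₄₅**: for every `κ_E ≥ 10712/10⁷ = 1.0712·10⁻³` and all `C_E, D_E`,
`¬ SchurElasticPricing (1/20) (1/8) w₄₅ ω₄ (3/400) (−7175/10000) κ_E C_E D_E`. [folklore] -/
theorem not_schurElasticPricing_fourHalf_of_ge {κE : ℝ} (hκ : (10712 : ℝ) / 10 ^ 7 ≤ κE) (CE DE : ℝ) :
    ¬ SchurElasticPricing (1 / 20) (1 / 8) w₄₅ ω₄ (3 / 400) (-(7175 / 10000)) κE CE DE := by
  refine cellE.not_schurElasticPricing_fourHalf_of_check cellECert cellE_checkGeom cellE_checkClass ?_ CE DE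
  have hN : ((cellE.N₀ : ℕ) : ℝ) = 16 := by norm_num [cellE]
  rw [hN]
  calc _ < (((16 * (-(7175 / 10000) + 10712 / 10 ^ 7) : ℚ)) : ℝ) := (Rat.cast_lt (K := ℝ)).2 cellE_total
    _ ≤ 16 * (-(7175 / 10000) + _) := by push_cast; nlinarith

/-- The ceiling at the round value `κ_E = 1.0712·10⁻³` itself. [folklore] -/
theorem not_schurElasticPricing_fourHalf_10712 (CE DE : ℝ) :
    ¬ SchurElasticPricing (1 / 20) (1 / 8) w₄₅ ω₄ (3 / 400) (-(7175 / 10000)) ((10712 : ℝ) / 10 ^ 7) CE DE :=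
  not_schurElasticPricing_fourHalf_of_ge le_rfl CE DE

end Summit.AtomisticToContinuum.Crystallization.Theorems.FrustratedLawDichotomyCellEflatCeiling
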